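import Summits.HodgeConjecture.HodgeConjecture.Theorems.TropicalKugaSatakeCayleyEffectiveCayleyNonRealizabilitySixthDirectionKernelCore
import Summits.HodgeConjecture.HodgeConjecture.Theorems.TropicalKugaSatakeCayleyEffectiveCayleyNonRealizabilitySixthDirectionKernelReduction
import Summits.HodgeConjecture.HodgeConjecture.Theorems.TropicalKugaSatakeCayleyEffectiveCayleyNonRealizabilitySixthDirectionGenerators
import Summits.HodgeConjecture.HodgeConjecture.Theorems.TropicalKugaSatakeCayleyEffectiveCayleyNonRealizabilityFormalClassKernelFamily
import HarnessLib

/-!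
# The sixth-direction kernel certificate `K₊ ∩ ℚ^{28×28} = ℚ • 1` and the rung
# `stub_rung_sixthDirection` — crux `EffectiveCayleyNonRealizability` (stmt-HodgeConjecture-18569),
# line `formal_rational`

Route `TropicalKugaSatakeCayley` of `HodgeConjecture`. Assembly of the kernel certificate for the
six-parameter family `F₊ = F_KS ⊕ ℚ B₆` of the rank-7 Kuga–Satake tori:

1. `sixthDirection_kernelCertificate_rat` — a rational class `Mq ∈ ⋀²ℚ⁸ ⊗ ⋀²ℚ⁸` killed by the
   eigenwave of each of the six generators `ksForm 0, …, ksForm 4, B₆` is a multiple of `1`: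
   by `…SixthDirectionKernelReduction` every slice of the antisymmetric reading `N` of `Mq`
   solves the three-term system of the six generators, by `…SixthDirectionGenerators` (row
   structure) that is the monomial table system of `…SixthDirectionKernelCore`, whose solution
   space is `⊕_c ℚ · (e_c ∧ Id)` slice by slice; antisymmetry between the two index pairs of `Mq`
   then leaves only `ℚ • 1` (`eq_smul_one_of_slices`).
2. `sixthDirection_kernelCertificate` — the real-parameter form: the hypothesis
   `∀ s ∈ ℝ⁶, eigenwave (compound 2 (B⁺_s) · Mq) = 0` of
   `stub_rung_sixthDirection_of_kernelCertificate` (`…FormalClassKernelFamily`), specialised at the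
   unit vectors and pulled back to `ℚ`.
3. `rung_sixthDirection`, `stub_rung_sixthDirection_unfolded` — THE RUNG, unconditionally: every formal framed
   `2`-chain over `ℚ[s₀,…,s₅]` with constant rational period class `Mq` on a non-empty open set of
   positive-definite parameters of `F₊` has `Mq ∈ ℚ • 1` ("fully flexible ⟹ Lefschetz",
   `dim Hdg₂(F₊) = 1`; the registered plan-only rung of line `formal_rational`, skeleton-local
   definitions unfolded as in `…FormalClassKernelFamily`).

No definition, no named fact, no sorry; kernel-checked finite identities only (`decide`,
`linear_combination`), no `native_decide`.
References: [MikhalkinZharkov2014Eigenwave] G. Mikhalkin, I. Zharkov, Tropical eigenwave and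
intermediate Jacobians, LN UMI 15 (2014), Thm. 5.4; [Zharkov2020TropicalWeil] I. Zharkov,
arXiv:2002.02347, pp. 2–3; prior programme archive `hodge-neg/tropical-kuga-satake`, paper-v2
Thm. E / §5 (`dim Hdg₂(F₊) = 1`).
-/

noncomputable section

-- `Summit.HodgeConjecture.HodgeConjecture.…` is the mandated namespace (single-conjunct summit).
set_option linter.dupNamespace false

open scoped BigOperators Matrix

namespace Summit.HodgeConjecture.HodgeConjecture.Theorems.EffectiveCayleyNonRealizability

open Literature.AlgebraicGeometry.Tropical
open Literature.AlgebraicGeometry.Tropical.TropicalTorus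

/-! ### From the slice structure to `ℚ • 1` -/

/-- A `2`-subset of `Fin 8` is an increasing pair. [folklore] -/
theorem sub_two_eq_pair (I : Sub 8 2) :
    ∃ x x' : Fin 8, ∃ h : x < x', I = ⟨{x, x'}, Finset.card_pair h.ne⟩ := by
  obtain ⟨a, b, hab, hs⟩ := Finset.card_eq_two.1 I.2
  rcases lt_or_gt_of_ne hab with h | h
  · exact ⟨a, b, h, Subtype.ext hs⟩
  · exact ⟨b, a, h, Subtype.ext (hs.trans (Finset.pair_comm a b))⟩

/-- **From slices to `ℚ • 1`.** If the antisymmetric reading `N(x, x'; j, j') = ± Mq_{{x,x'},{j,j'}}`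
of `Mq` vanishes whenever `x' ∉ {j, j'}` and `N(x, x'; c, x')` does not depend on `x' ≠ c` (the
conclusions of `sixthKernel_core` for every slice `x`), then `Mq ∈ ℚ • 1`. [folklore] -/
theorem eq_smul_one_of_slices (Mq : Matrix (Sub 8 2) (Sub 8 2) ℚ)
    (N : Fin 8 → Fin 8 → Fin 8 → Fin 8 → ℚ)
    (hN : ∀ (x x' j j' : Fin 8) (hx : x < x') (hj : j < j'),
      N x x' j j' = Mq ⟨{x, x'}, Finset.card_pair hx.ne⟩ ⟨{j, j'}, Finset.card_pair hj.ne⟩)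
    (ha₁ : ∀ x x' j j', N x' x j j' = -N x x' j j') (ha₂ : ∀ x x' j j', N x x' j' j = -N x x' j j')
    (hz : ∀ x x' j j' : Fin 8, x' ≠ j → x' ≠ j' → N x x' j j' = 0)
    (hc : ∀ x c x' x'' : Fin 8, x' ≠ c → x'' ≠ c → N x x' c x' = N x x'' c x'') :
    ∃ r : ℚ, Mq = r • (1 : Matrix (Sub 8 2) (Sub 8 2) ℚ) := by
  -- the diagonal value
  have hdd : ∀ x x' : Fin 8, x ≠ x' → N x x' x x' = N 0 1 0 1 := by
    intro x x' hxx'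
    by_cases hx0 : x = 0
    · subst hx0
      exact hc 0 0 x' 1 (Ne.symm hxx') one_ne_zero
    · rw [hc x x x' 0 (Ne.symm hxx') (Ne.symm hx0), ha₁ 0 x x 0, ha₂ 0 x 0 x, neg_neg]
      exact hc 0 0 x 1 hx0 one_ne_zero
  refine ⟨N 0 1 0 1, ?_⟩
  ext I J
  obtain ⟨x, x', hx, rfl⟩ := sub_two_eq_pair I
  obtain ⟨j, j', hj, rfl⟩ := sub_two_eq_pair J
  rw [← hN x x' j j' hx hj, Matrix.smul_apply, Matrix.one_apply, smul_eq_mul, mul_ite, mul_one,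
    mul_zero]
  by_cases hIJ : (⟨{x, x'}, Finset.card_pair hx.ne⟩ : Sub 8 2) = ⟨{j, j'}, Finset.card_pair hj.ne⟩
  · -- diagonal entry: `{x, x'} = {j, j'}` with both pairs increasing
    rw [if_pos hIJ]
    have hs : ({x, x'} : Finset (Fin 8)) = {j, j'} := congrArg Subtype.val hIJ
    have hxm : x ∈ ({j, j'} : Finset (Fin 8)) := hs ▸ Finset.mem_insert_self x {x'}
    have hx'm : x' ∈ ({j, j'} : Finset (Fin 8)) := hs ▸ Finset.mem_insert_of_mem (Finset.mem_singleton_self x')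
    simp only [Finset.mem_insert, Finset.mem_singleton] at hxm hx'm
    have hxj : x = j := by
      rcases hxm with h | h
      · exact h
      · exfalso
        rcases hx'm with h' | h'
        · have hlt : x' < x := by rw [h, h']; exact hj
          exact lt_asymm hx hlt
        · exact hx.ne (h.trans h'.symm)
    subst hxj
    have hx'j' : x' = j' := by
      rcases hx'm with h' | h'
      · exact absurd h' hx.ne'
      · exact h'
    subst hx'j'
    exact hdd x x' hx.ne
  · rw [if_neg hIJ]
    by_cases h1 : x' ≠ j ∧ x' ≠ j'
    · exact hz x x' j j' h1.1 h1.2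
    · by_cases h2 : x ≠ j ∧ x ≠ j'
      · rw [ha₁ x' x j j', hz x' x j j' h2.1 h2.2, neg_zero]
      · -- both `x` and `x'` lie in `{j, j'}`: then the pairs coincide
        exfalso
        apply hIJ
        apply Subtype.ext
        have hxm : x ∈ ({j, j'} : Finset (Fin 8)) := by
          simp only [Finset.mem_insert, Finset.mem_singleton]; tauto
        have hx'm : x' ∈ ({j, j'} : Finset (Fin 8)) := by
          simp only [Finset.mem_insert, Finset.mem_singleton]; tauto
        exact Finset.eq_of_subset_of_card_le
          (Finset.insert_subset hxm (Finset.singleton_subset_iff.2 hx'm))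
          (by rw [Finset.card_pair hj.ne, Finset.card_pair hx.ne])

/-! ### The antisymmetric reading of a class -/

/-- Row sums against `ksForm 0 = D`: `Σ_{x'} D_{k x'} f(x') = D_k f(k)`. [folklore] -/
theorem sixthGenerators_row_sum_zero (k : Fin 8) (f : Fin 8 → ℚ) :
    ∑ x', (((![ksForm 0, ksForm 1, ksForm 2, ksForm 3, ksForm 4, !![0, 0, 0, 0, 0, 0, 0, -16; 0, 0, 0, 0, 0, 0, 16,
        0; 0, 0, 0, 0, 0, -16, 0, 0; 0, 0, 0, 0, 16, 0, 0, 0; 0, 0, 0, 16, 0, 0, 0, 0; 0, 0, -16, 0, 0, 0, 0, 0; 0,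
        16, 0, 0, 0, 0, 0, 0; -16, 0, 0, 0, 0, 0, 0,
        0]] : Fin 6 → Matrix (Fin 8) (Fin 8) ℤ) 0).map (Int.cast : ℤ → ℚ)) k x' * f x' = (![2, 4, 4, 8, 4, 8, 8,
        16] : Fin 8 → ℚ) k * f k := by
  rw [sixthGenerators_row_sum]
  have h0 : ∀ k : Fin 8, k ^^^ (0 : Fin 8) = k := by decide
  simp only [Matrix.cons_val_zero, zero_mul, zero_add, h0]

/-- **The rational kernel certificate `K₊ ∩ ℚ^{28×28} = ℚ • 1`.** A rational class killed by the
eigenwave of each of the six generators of `F₊` is a rational multiple of `1`.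
[cite: MikhalkinZharkov2014Eigenwave, Thm. 5.4] -/
theorem sixthDirection_kernelCertificate_rat (Mq : Matrix (Sub 8 2) (Sub 8 2) ℚ)
    (h : ∀ l : Fin 6, eigenwave (q := 1) (compound 2 (((![ksForm 0, ksForm 1, ksForm 2, ksForm 3, ksForm 4, !![0, 0,
        0, 0, 0, 0, 0, -16; 0, 0, 0, 0, 0, 0, 16, 0; 0, 0, 0, 0, 0, -16, 0, 0; 0, 0, 0, 0, 16, 0, 0, 0; 0, 0, 0, 16,
        0, 0, 0, 0; 0, 0, -16, 0, 0, 0, 0, 0; 0, 16, 0, 0, 0, 0, 0, 0; -16, 0, 0, 0, 0, 0, 0,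
        0]] : Fin 6 → Matrix (Fin 8) (Fin 8) ℤ) l).map (Int.cast : ℤ → ℚ)) * Mq) = 0) :
    ∃ r : ℚ, Mq = r • (1 : Matrix (Sub 8 2) (Sub 8 2) ℚ) := by
  -- the antisymmetric reading `N(x, x'; j, j') = σ(x, x') σ(j, j') Mq_{{x,x'},{j,j'}}`
  let E : Finset (Fin 8) → Finset (Fin 8) → ℚ := fun K L =>
    if hKL : K.card = 2 ∧ L.card = 2 then Mq ⟨K, hKL.1⟩ ⟨L, hKL.2⟩ else 0
  let σ : Fin 8 → Fin 8 → ℚ := fun a b => if a < b then 1 else if b < a then -1 else 0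
  let N : Fin 8 → Fin 8 → Fin 8 → Fin 8 → ℚ := fun x x' j j' => σ x x' * σ j j' * E {x, x'} {j, j'}
  have hσlt : ∀ a b : Fin 8, a < b → σ a b = 1 := fun a b h => by simp only [σ, if_pos h]
  have hσanti : ∀ a b : Fin 8, σ b a = -σ a b := by
    intro a b
    rcases lt_trichotomy a b with h | rfl | h
    · simp only [σ, if_pos h, if_neg (lt_asymm h)]
    · simp only [σ, lt_irrefl, if_false, neg_zero]
    · simp only [σ, if_pos h, if_neg (lt_asymm h), neg_neg]
  have hσself : ∀ a : Fin 8, σ a a = 0 := fun a => by simp only [σ, lt_irrefl, if_false]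
  have hN : ∀ (x x' j j' : Fin 8) (hx : x < x') (hj : j < j'),
      N x x' j j' = Mq ⟨{x, x'}, Finset.card_pair hx.ne⟩ ⟨{j, j'}, Finset.card_pair hj.ne⟩ := by
    intro x x' j j' hx hj
    simp only [N, E, hσlt x x' hx, hσlt j j' hj, one_mul,
      dif_pos (And.intro (Finset.card_pair hx.ne) (Finset.card_pair hj.ne))]
  have ha₁ : ∀ x x' j j', N x' x j j' = -N x x' j j' := by
    intro x x' j j'
    simp only [N]
    rw [hσanti x x', Finset.pair_comm x' x]; ring
  have hd₁ : ∀ x j j', N x x j j' = 0 := by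
    intro x j j'; simp only [N, hσself, zero_mul]
  have ha₂ : ∀ x x' j j', N x x' j' j = -N x x' j j' := by
    intro x x' j j'
    simp only [N]
    rw [hσanti j j', Finset.pair_comm j' j]; ring
  have hd₂ : ∀ x x' j, N x x' j j = 0 := by
    intro x x' j; simp only [N, hσself, mul_zero, zero_mul]
  -- every slice solves the monomial table system of the six generators
  have hsys : ∀ (x : Fin 8) (l : Fin 6) (k₁ k₂ k₃ : Fin 8),
      (![![2, 4, 4, 8, 4, 8, 8, 16], ![2, -4, -4, 8, -4, 8, 8, -16], ![-4, -4, 8, 8, 8, 8, -16, -16], ![-4, -8, -4,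
          -8, 8, 16, 8, 16], ![-4, -8, -8, -16, -4, -8, -8, -16], ![-16, 16, -16, 16, 16, -16, 16,
          -16]] : Fin 6 → Fin 8 → ℚ) l k₁ * N x (k₁ ^^^ (![0, 0, 1, 2, 4, 7] : Fin 6 → Fin 8) l) k₂ k₃ + (![![2, 4,
          4, 8, 4, 8, 8, 16], ![2, -4, -4, 8, -4, 8, 8, -16], ![-4, -4, 8, 8, 8, 8, -16, -16], ![-4, -8, -4, -8, 8,
          16, 8, 16], ![-4, -8, -8, -16, -4, -8, -8, -16], ![-16, 16, -16, 16, 16, -16, 16,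
          -16]] : Fin 6 → Fin 8 → ℚ) l k₂ * N x (k₂ ^^^ (![0, 0, 1, 2, 4, 7] : Fin 6 → Fin 8) l) k₃ k₁ +
        (![![2, 4, 4, 8, 4, 8, 8, 16], ![2, -4, -4, 8, -4, 8, 8, -16], ![-4, -4, 8, 8, 8, 8, -16, -16], ![-4, -8, -4,
            -8, 8, 16, 8, 16], ![-4, -8, -8, -16, -4, -8, -8, -16], ![-16, 16, -16, 16, 16, -16, 16,
            -16]] : Fin 6 → Fin 8 → ℚ) l k₃ * N x (k₃ ^^^ (![0, 0, 1, 2, 4, 7] : Fin 6 → Fin 8) l) k₁ k₂ = 0 := by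
    intro x l k₁ k₂ k₃
    have eB := sliceSystem_of_eigenwave_eq_zero _ _ (sixthGenerators_leftInverse l) Mq N hN ha₁ hd₁
      ha₂ hd₂ (h l) x k₁ k₂ k₃
    have eD := sliceSystem_of_eigenwave_eq_zero _ _ (sixthGenerators_leftInverse 0) Mq N hN ha₁ hd₁
      ha₂ hd₂ (h 0) x k₁ k₂ k₃
    rw [sixthGenerators_row_sum, sixthGenerators_row_sum, sixthGenerators_row_sum] at eB
    rw [sixthGenerators_row_sum_zero, sixthGenerators_row_sum_zero, sixthGenerators_row_sum_zero]
      at eD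
    linear_combination eB - (![0, 2, 2, 2, 2, 0] : Fin 6 → ℚ) l * eD
  -- the core, slice by slice
  have core := fun x : Fin 8 => sixthKernel_core (N x) (fun x' j j' => ha₂ x x' j j') (hsys x)
  exact eq_smul_one_of_slices Mq N hN ha₁ ha₂ (fun x x' j j' h1 h2 => (core x).1 x' j j' h1 h2)
    (fun x c x' x'' h1 h2 => (core x).2 c x' x'' h1 h2)

/-! ### The certificate in the real-parameter form, and the rung -/

/-- **The kernel certificate `K₊ ∩ ℚ^{28×28} = ℚ • 1`** in the form required by
`stub_rung_sixthDirection_of_kernelCertificate`: a rational `Mq` with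
`eigenwave (compound 2 (B⁺_s) · Mq) = 0` for every real parameter `s ∈ ℝ⁶` of the six-parameter
family `B⁺_s = Σ_{i<5} s_i ksForm i + s_5 B₆` is a rational multiple of `1` (exact computation of
record `dim K₊ = 1`, here kernel-checked). [cite: MikhalkinZharkov2014Eigenwave, Thm. 5.4] -/
theorem sixthDirection_kernelCertificate : ∀ Mq : Matrix (Sub 8 2) (Sub 8 2) ℚ,
    (∀ s : Fin 6 → ℝ, eigenwave (q := 1) (compound 2
      ((∑ i : Fin 5, s (Fin.castSucc i) • (ksForm i).map (Int.cast : ℤ → ℝ)) +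
        s (Fin.last 5) • (ksBase * ksClifford 0 * ksClifford 1 * ksClifford 2 * ksClifford 3).map
          (Int.cast : ℤ → ℝ)) * Mq.map (algebraMap ℚ ℝ)) = 0) →
    ∃ r : ℚ, Mq = r • (1 : Matrix (Sub 8 2) (Sub 8 2) ℚ) := by
  intro Mq h
  refine sixthDirection_kernelCertificate_rat Mq fun l => ?_
  have e := h (Pi.single l 1)
  rw [ksMatrixPlus_single l] at e
  exact (eigenwave_compound_intCast_eq_zero_iff _ Mq).1 e

/-- **THE RUNG (sixth direction, "fully flexible ⟹ Lefschetz").** Every formal framed `2`-chain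
over `ℚ[s₀,…,s₅]` whose evaluations have constant rational period class `Mq` on a non-empty open set
of positive-definite parameters of the six-parameter family `F₊ = F_KS ⊕ ℚ B₆` has `Mq ∈ ℚ • 1`:
formal cycle classes over `F₊` lie in `Hdg₂(F₊) = ℚ • 1`.
[cite: MikhalkinZharkov2014Eigenwave, Thm. 5.4] [cite: Zharkov2020TropicalWeil, pp. 2–3] -/
theorem rung_sixthDirection :
    ∀ 𝒵 : Chain (MvPolynomial (Fin 6) ℚ) 8 2,
      ∀ V : Set (Fin 6 → ℝ), IsOpen V → V.Nonempty →
        (∀ s ∈ V, ((∑ i : Fin 5, s (Fin.castSucc i) • (ksForm i).map (Int.cast : ℤ → ℝ)) +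
          s (Fin.last 5) • (ksBase * ksClifford 0 * ksClifford 1 * ksClifford 2 * ksClifford 3).map
            (Int.cast : ℤ → ℝ)).PosDef) →
        ∀ Mq : Matrix (Sub 8 2) (Sub 8 2) ℚ,
          (∀ s ∈ V, compound 2 ((∑ i : Fin 5, s (Fin.castSucc i) • (ksForm i).map (Int.cast : ℤ → ℝ)) +
              s (Fin.last 5) • (ksBase * ksClifford 0 * ksClifford 1 * ksClifford 2 *
                ksClifford 3).map (Int.cast : ℤ → ℝ))⁻¹ *
            (⟨𝒵.size, fun c => ⟨fun r => MvPolynomial.aeval s ((𝒵.cell c).base r), (𝒵.cell c).dir,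
                fun i j => MvPolynomial.aeval s ((𝒵.cell c).coef i j), (𝒵.cell c).weight⟩⟩ :
                Chain ℝ 8 2).classOf = Mq.map (algebraMap ℚ ℝ)) →
          ∃ r : ℚ, Mq = r • (1 : Matrix (Sub 8 2) (Sub 8 2) ℚ) :=
  rung_sixthDirection_of_kernelCertificate sixthDirection_kernelCertificate

/-- **The registered rung `stub_rung_sixthDirection` of line `formal_rational`, PROVED** (statement
verbatim up to unfolding of the skeleton-local `ksSixth` / `ksMatrixPlus` / `ksMatrixPlusPoly` /
`evalChain₆`; its hypotheses `IsAffineLinear`, formal `IsCycle` and `Effective` are not needed).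
[cite: MikhalkinZharkov2014Eigenwave, Thm. 5.4] [cite: Zharkov2020TropicalWeil, pp. 2–3] -/
theorem stub_rung_sixthDirection_unfolded :
    ∀ 𝒵 : Chain (MvPolynomial (Fin 6) ℚ) 8 2, 𝒵.IsAffineLinear →
      𝒵.IsCycle ((∑ i : Fin 5, (MvPolynomial.X (Fin.castSucc i) : MvPolynomial (Fin 6) ℚ) •
          (ksForm i).map (Int.cast : ℤ → MvPolynomial (Fin 6) ℚ)) +
        (MvPolynomial.X (Fin.last 5) : MvPolynomial (Fin 6) ℚ) •
          (ksBase * ksClifford 0 * ksClifford 1 * ksClifford 2 * ksClifford 3).map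
            (Int.cast : ℤ → MvPolynomial (Fin 6) ℚ)) →
      ∀ V : Set (Fin 6 → ℝ), IsOpen V → V.Nonempty →
        (∀ s ∈ V, ((∑ i : Fin 5, s (Fin.castSucc i) • (ksForm i).map (Int.cast : ℤ → ℝ)) +
          s (Fin.last 5) • (ksBase * ksClifford 0 * ksClifford 1 * ksClifford 2 * ksClifford 3).map
            (Int.cast : ℤ → ℝ)).PosDef) →
        ∀ Mq : Matrix (Sub 8 2) (Sub 8 2) ℚ,
          (∀ s ∈ V,
            (⟨𝒵.size, fun c => ⟨fun r => MvPolynomial.aeval s ((𝒵.cell c).base r), (𝒵.cell c).dir,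
                fun i j => MvPolynomial.aeval s ((𝒵.cell c).coef i j), (𝒵.cell c).weight⟩⟩ :
                Chain ℝ 8 2).Effective ∧
            compound 2 ((∑ i : Fin 5, s (Fin.castSucc i) • (ksForm i).map (Int.cast : ℤ → ℝ)) +
              s (Fin.last 5) • (ksBase * ksClifford 0 * ksClifford 1 * ksClifford 2 *
                ksClifford 3).map (Int.cast : ℤ → ℝ))⁻¹ *
            (⟨𝒵.size, fun c => ⟨fun r => MvPolynomial.aeval s ((𝒵.cell c).base r), (𝒵.cell c).dir,
                fun i j => MvPolynomial.aeval s ((𝒵.cell c).coef i j), (𝒵.cell c).weight⟩⟩ :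
                Chain ℝ 8 2).classOf = Mq.map (algebraMap ℚ ℝ)) →
          ∃ r : ℚ, Mq = r • (1 : Matrix (Sub 8 2) (Sub 8 2) ℚ) :=
  stub_rung_sixthDirection_of_kernelCertificate sixthDirection_kernelCertificate

end Summit.HodgeConjecture.HodgeConjecture.Theorems.EffectiveCayleyNonRealizability

end
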